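import Literature.MathematicalPhysics.QuantumFieldTheory.ConformalBootstrap3D.HRCoeffIntervalBounds

/-!
# Residue-scaled coefficient tables at the scalar unitarity bound (`ℓ = 0`, cells touching `Δ = 1/2`)

The interval tables `hrCoeffLo/Hi Δ₁ Δ₂ ℓ` (`HRCoeffIntervalBounds`) enclose the Hogervorst–Rychkov
coefficients `A_{n,j}(Δ)` (`hrCoeff Δ ℓ n j`, recursion (3.9)) on a cell `[Δ₁, Δ₂]` only when
`unitarityBound3D ℓ < Δ₁`, and the monotone tables (`HRCoeffCellBounds`, `MixedHeadBound`) need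
`ℓ + 1 ≤ Δ₁`. For a SCALAR row (`ℓ = 0`, bound `1/2`) neither reaches the bound: the level-two pivot
`C_{Δ+2,0} - C_{Δ,0} = 4Δ - 2` (`casimirPivot3D Δ 0 2 0`) vanishes at `Δ = 1/2` — the free-scalar pole
of Kos–Poland–Simmons-Duffin 2014, §4 Table 1 (type II, `k = 1`), `A_{2,0} = Δ(Δ-1)²/(24(Δ-1/2))` — so
the interval tables blow up as `Δ₁ ↓ 1/2` and no finite family of cells `[Δ₁, Δ₂]`, `Δ₁ > 1/2`, covers
a row that must start AT the bound (a sector with no gap assumption, e.g. the traceless-symmetric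
scalars of the `O(N)` archipelago, Kos–Poland–Simmons-Duffin–Vichi 2015 §3, or every scalar row of an
assumption-free single-correlator bound).

This file removes the obstruction at the coefficient level. The pole is SIMPLE and sits in the one
pivot `(2,0)`; every other pivot of the scalar recursion on the descendant range is `≥ 3` (levels
`n ≥ 3`) or `= 4Δ + 4` (the pair `(2,2)`) on the CLOSED region `Δ ≥ 1/2`
(`casimirPivot3D_scalar_pos_of_half_le`). Hence the RESIDUE-SCALED coefficients
`B_{n,j}(Δ) := (4Δ - 2) · A_{n,j}(Δ)` satisfy: `B_{0,0} = 4Δ - 2`, `B_{1,1} = (4Δ-2)Δ/2`,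
`B_{2,0} = γ⁻_{Δ+1,1} · Δ/2` (the pivot cancelled EXACTLY, `scaled_hrCoeff_two_zero`),
`B_{2,2} = (4Δ-2) γ⁺_{Δ+1,1} (Δ/2) / (4Δ+4)`, and from level three on the SAME linear recursion (3.9)
as the `A`'s (`scaled_hrCoeff_succ`). Running that recursion in interval arithmetic exactly as in
`HRCoeffIntervalBounds` (squares of affine functions enclosed by `sqLower/sqUpper`, pivots monotone and
now positive down to `Δ₁ = 1/2`) gives two finite rational tables

* `hrCoeffHalfLo Δ₁ Δ₂ n j`, `hrCoeffHalfHi Δ₁ Δ₂ n j` (levels `0, 1, 2` in closed form, level `n + 3`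
  by the recursion with lower `γ`'s / pivot at `Δ₂`, resp. upper `γ`'s / pivot at `Δ₁`),

and the enclosure theorem

* `scaled_hrCoeff_sandwich`: for `1/2 ≤ Δ₁ ≤ Δ ≤ Δ₂` with `1/2 < Δ`, for all `n, j`,
  `0 ≤ hrCoeffHalfLo Δ₁ Δ₂ n j ≤ (4Δ - 2) · A_{n,j}(Δ) ≤ hrCoeffHalfHi Δ₁ Δ₂ n j`.

The left table parameter MAY BE the bound itself (`Δ₁ = 1/2`), so ONE cell `(1/2, Δ₂]` is certified
by one pair of tables; the point `Δ = 1/2` needs nothing: no function is a `Δ₁₂ = Δ₃₄ = 0` block of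
dimension `1/2` (`BlockFreeScalarPole.not_isConformalBlock3D_freeScalar_zero_zero`), so block
positivity there is vacuous, and for rows typed by continuity from the right the `*_of_eventually_right`
lemmas (`BoundaryCellPositivity`) apply. USE in a head-cell rule: on the open cell `4Δ - 2 > 0`, so
`0 ≤ Σ_{(n,j)} A_{n,j}(Δ) T_{n,j}` follows from `0 ≤ Σ B_{n,j}(Δ) T_{n,j}` (`nonneg_of_scaled_nonneg`),
and the latter from the table numbers through `min_mul_le_mul_of_bounds` exactly as with `hrCoeffLo/Hi`
— the head theorems themselves are not restated here. Slack: as for the interval tables, one factor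
`(1 + O(Δ₂ - Δ₁))` per level; the scaled level-two entries are products of monotone enclosures.

References: M. Hogervorst, S. Rychkov, Phys. Rev. D 87 (2013) 106004, §3 eqs. (3.8)–(3.9)
[cite: HogervorstRychkov2013, §3 eq. (3.9)]; F. Kos, D. Poland, D. Simmons-Duffin, JHEP 11 (2014) 109,
§4 eqs. (4.2)–(4.3), Table 1 [cite: KosPolandSimmonsduffin2014, §4 eqs. (4.2)–(4.3)]; F. Kos, D. Poland,
D. Simmons-Duffin, A. Vichi, JHEP 11 (2015) 106, §3 (positivity imposed from the unitarity bound
`Δ ≥ (D-2)/2` for scalars) [cite: KosPolandSimmonsDuffinVichi2015, §3].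
-/

noncomputable section

namespace Literature.MathematicalPhysics.QuantumFieldTheory.ConformalBootstrap3D

open Set

/-! ### The scalar recursion on the closed region `Δ ≥ 1/2` -/

/-- The level-two, spin-zero pivot of the scalar recursion is `4Δ - 2`: the simple zero at the
unitarity bound `Δ = 1/2` (free-scalar pole, type II `k = 1`).
[cite: KosPolandSimmonsduffin2014, §4 eqs. (4.2)–(4.3)] -/
theorem casimirPivot3D_scalar_level_two_zero (Δ : ℝ) : casimirPivot3D Δ 0 (1 + 1) 0 = 4 * Δ - 2 := by
  unfold casimirPivot3D; push_cast; ring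

/-- The level-two, spin-two pivot of the scalar recursion is `4Δ + 4`.
[cite: HogervorstRychkov2013, §3 after eq. (3.9)] -/
theorem casimirPivot3D_scalar_level_two_two (Δ : ℝ) : casimirPivot3D Δ 0 (1 + 1) 2 = 4 * Δ + 4 := by
  unfold casimirPivot3D; push_cast; ring

/-- On the CLOSED region `Δ ≥ 1/2` every pivot of the scalar (`ℓ = 0`) recursion on the descendant
range at a level `n ≥ 2`, other than the pair `(2,0)`, is positive: `(2,2)` gives `4Δ + 4`, and for
`n ≥ 3` the pivot is `≥ n(n-2) ≥ 3`. [cite: HogervorstRychkov2013, §3 after eq. (3.9)] -/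
theorem casimirPivot3D_scalar_pos_of_half_le {Δ : ℝ} (hΔ : 1 / 2 ≤ Δ) {n j : ℕ} (hn : 2 ≤ n)
    (h20 : ¬ (n = 2 ∧ j = 0)) (hr : InDescendantRange 0 n j) : 0 < casimirPivot3D Δ 0 n j := by
  obtain ⟨-, hju, hpar⟩ := hr
  rcases Nat.lt_or_ge n 3 with h3 | h3
  · have hn2 : n = 2 := by omega
    subst hn2
    have hj2 : j = 2 := by omega
    subst hj2
    unfold casimirPivot3D; push_cast; linarith
  · have hn' : (3 : ℝ) ≤ (n : ℝ) := by exact_mod_cast h3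
    have hj : (0 : ℝ) ≤ (j : ℝ) * ((j : ℝ) + 1) := by positivity
    have h4 : (0 : ℝ) ≤ ((n : ℝ) - 3) * ((n : ℝ) + 1) := mul_nonneg (by linarith) (by linarith)
    have h5 : (0 : ℝ) ≤ (n : ℝ) * (Δ - 1 / 2) := mul_nonneg (by linarith) (by linarith)
    unfold casimirPivot3D; push_cast; nlinarith

/-- Positivity of `4Δ - 2` on the open cell. [folklore] -/
private theorem four_mul_sub_two_pos {Δ : ℝ} (hΔ : 1 / 2 < Δ) : 0 < 4 * Δ - 2 := by linarith

/-- **Dividing out the residue scale.** On the open cell `Δ > 1/2`, `0 ≤ (4Δ - 2)·x` gives `0 ≤ x`: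
a head inequality certified for the scaled coefficients `B_{n,j} = (4Δ-2) A_{n,j}` is the head
inequality for the `A_{n,j}`. [cite: HogervorstRychkov2013, §3 eq. (3.9)] -/
theorem nonneg_of_scaled_nonneg {Δ x : ℝ} (hΔ : 1 / 2 < Δ) (h : 0 ≤ (4 * Δ - 2) * x) : 0 ≤ x :=
  (mul_nonneg_iff_of_pos_left (four_mul_sub_two_pos hΔ)).mp h

/-- `A_{1,1}(Δ, ℓ = 0) = Δ/2` above the bound. [cite: HogervorstRychkov2013, §3 eq. (3.10)] -/
theorem hrCoeff_scalar_one_one {Δ : ℝ} (hΔ : 1 / 2 < Δ) : hrCoeff Δ 0 1 1 = Δ / 2 := by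
  have hb : unitarityBound3D 0 < Δ := by simpa [unitarityBound3D] using hΔ
  have h := hrCoeff_one_succ (ℓ := 0) hb
  norm_num at h
  linarith

/-- Level one of the scalar recursion is supported on `j = 1`. [cite: HogervorstRychkov2013, §3 eq. (3.5)] -/
theorem hrCoeff_scalar_one_of_ne (Δ : ℝ) {j : ℕ} (hj : j ≠ 1) : hrCoeff Δ 0 1 j = 0 :=
  hrCoeff_eq_zero_of_not_inDescendantRange Δ (by rintro ⟨-, h2, h3⟩; omega)

/-- Level two of the scalar recursion is supported on `j ∈ {0, 2}`.
[cite: HogervorstRychkov2013, §3 eq. (3.5)] -/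
theorem hrCoeff_scalar_two_of_ne (Δ : ℝ) {j : ℕ} (hj0 : j ≠ 0) (hj2 : j ≠ 2) : hrCoeff Δ 0 2 j = 0 :=
  hrCoeff_eq_zero_of_not_inDescendantRange Δ (by rintro ⟨-, h2, h3⟩; omega)

/-- **The exact cancellation at `(2,0)`.** For `Δ > 1/2`,
`(4Δ - 2) · A_{2,0}(Δ) = γ⁻_{Δ+1,1} · A_{1,1}(Δ) = γ⁻_{Δ+1,1} · Δ/2` — the vanishing pivot is divided
out, the right-hand side is polynomial (`= Δ(Δ-1)²/6`).
[cite: KosPolandSimmonsduffin2014, §4 eqs. (4.2)–(4.3)] -/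
theorem scaled_hrCoeff_two_zero {Δ : ℝ} (hΔ : 1 / 2 < Δ) :
    (4 * Δ - 2) * hrCoeff Δ 0 2 0 = hrGammaMinus (Δ + 1) 1 * (Δ / 2) := by
  have hne : (4 * Δ - 2) ≠ 0 := (four_mul_sub_two_pos hΔ).ne'
  show (4 * Δ - 2) * hrCoeff Δ 0 (1 + 1) 0 = _
  rw [hrCoeff_succ, casimirPivot3D_scalar_level_two_zero, ← hrCoeff_scalar_one_one hΔ]
  simp only [if_true, zero_add, Nat.cast_one]
  field_simp

/-- Level two, spin two: `(4Δ - 2) · A_{2,2}(Δ) = (4Δ - 2) · (γ⁺_{Δ+1,1} · Δ/2) / (4Δ + 4)`.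
[cite: HogervorstRychkov2013, §3 eq. (3.9)] -/
theorem scaled_hrCoeff_two_two {Δ : ℝ} (hΔ : 1 / 2 < Δ) :
    (4 * Δ - 2) * hrCoeff Δ 0 2 2 =
      (4 * Δ - 2) * (hrGammaPlus (Δ + 1) 1 * (Δ / 2) / casimirPivot3D Δ 0 2 2) := by
  show (4 * Δ - 2) * hrCoeff Δ 0 (1 + 1) 2 = _
  rw [hrCoeff_succ, ← hrCoeff_scalar_one_one hΔ]
  simp only [Nat.reduceSub, Nat.reduceAdd, hrCoeff_scalar_one_of_ne Δ (show (3 : ℕ) ≠ 1 by norm_num),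
    show ¬ ((2 : ℕ) = 0) from by omega, if_false, mul_zero, add_zero, Nat.cast_one]

/-- The recursion (3.9) is LINEAR, so the scaled coefficients `B_{n,j} = (4Δ-2) A_{n,j}` obey it too:
`B_{n+1,j} = (γ⁺_{Δ+n,j-1} B_{n,j-1} + γ⁻_{Δ+n,j+1} B_{n,j+1}) / (C_{Δ+n+1,j} - C_{Δ,0})`.
[cite: HogervorstRychkov2013, §3 eq. (3.9)] -/
theorem scaled_hrCoeff_succ (Δ : ℝ) (n j : ℕ) :
    (4 * Δ - 2) * hrCoeff Δ 0 (n + 1) j =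
      ((if j = 0 then 0 else hrGammaPlus (Δ + n) (j - 1) * ((4 * Δ - 2) * hrCoeff Δ 0 n (j - 1))) +
          hrGammaMinus (Δ + n) (j + 1) * ((4 * Δ - 2) * hrCoeff Δ 0 n (j + 1))) /
        casimirPivot3D Δ 0 (n + 1) j := by
  rw [hrCoeff_succ]
  split_ifs <;> ring

/-! ### The two residue-scaled tables -/

/-- **Lower residue-scaled table** for `B_{n,j}(Δ) = (4Δ-2) A_{n,j}(Δ)`, `Δ ∈ [Δ₁, Δ₂]`, `ℓ = 0`:
levels `0, 1, 2` in closed form (products of lower enclosures; at `(2,0)` the pivot is cancelled, at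
`(2,2)` it is evaluated at `Δ₂`), level `n + 3` by the recursion with the lower `γ`-enclosures and the
pivot at `Δ₂`; `0` off the descendant range. A finite rational computation for rational `Δ₁, Δ₂`.
[cite: HogervorstRychkov2013, §3 eq. (3.9)] -/
noncomputable def hrCoeffHalfLo (Δ₁ Δ₂ : ℝ) : ℕ → ℕ → ℝ
  | 0, j => if j = 0 then 4 * Δ₁ - 2 else 0
  | 1, j => if j = 1 then (4 * Δ₁ - 2) * (Δ₁ / 2) else 0
  | 2, j =>
      if j = 0 then hrGammaMinusLo (Δ₁ + 1) (Δ₂ + 1) 1 * (Δ₁ / 2)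
      else if j = 2 then
        (4 * Δ₁ - 2) * (hrGammaPlusLo (Δ₁ + 1) (Δ₂ + 1) 1 * (Δ₁ / 2) / casimirPivot3D Δ₂ 0 2 2)
      else 0
  | n + 3, j =>
      if InDescendantRange 0 (n + 3) j then
        ((if j = 0 then 0 else
            hrGammaPlusLo (Δ₁ + (n + 2 : ℕ)) (Δ₂ + (n + 2 : ℕ)) (j - 1) * hrCoeffHalfLo Δ₁ Δ₂ (n + 2) (j - 1)) +
            hrGammaMinusLo (Δ₁ + (n + 2 : ℕ)) (Δ₂ + (n + 2 : ℕ)) (j + 1) * hrCoeffHalfLo Δ₁ Δ₂ (n + 2) (j + 1)) /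
          casimirPivot3D Δ₂ 0 (n + 3) j
      else 0

/-- **Upper residue-scaled table** for `B_{n,j}(Δ)`, `Δ ∈ [Δ₁, Δ₂]`, `ℓ = 0`: as `hrCoeffHalfLo` with
upper enclosures and the pivots evaluated at `Δ₁` (positive down to `Δ₁ = 1/2`).
[cite: HogervorstRychkov2013, §3 eq. (3.9)] -/
noncomputable def hrCoeffHalfHi (Δ₁ Δ₂ : ℝ) : ℕ → ℕ → ℝ
  | 0, j => if j = 0 then 4 * Δ₂ - 2 else 0
  | 1, j => if j = 1 then (4 * Δ₂ - 2) * (Δ₂ / 2) else 0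
  | 2, j =>
      if j = 0 then hrGammaMinusHi (Δ₁ + 1) (Δ₂ + 1) 1 * (Δ₂ / 2)
      else if j = 2 then
        (4 * Δ₂ - 2) * (hrGammaPlusHi (Δ₁ + 1) (Δ₂ + 1) 1 * (Δ₂ / 2) / casimirPivot3D Δ₁ 0 2 2)
      else 0
  | n + 3, j =>
      if InDescendantRange 0 (n + 3) j then
        ((if j = 0 then 0 else
            hrGammaPlusHi (Δ₁ + (n + 2 : ℕ)) (Δ₂ + (n + 2 : ℕ)) (j - 1) * hrCoeffHalfHi Δ₁ Δ₂ (n + 2) (j - 1)) +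
            hrGammaMinusHi (Δ₁ + (n + 2 : ℕ)) (Δ₂ + (n + 2 : ℕ)) (j + 1) * hrCoeffHalfHi Δ₁ Δ₂ (n + 2) (j + 1)) /
          casimirPivot3D Δ₁ 0 (n + 3) j
      else 0

/-- [folklore] -/
private theorem hrCoeffHalfLo_add_three (Δ₁ Δ₂ : ℝ) (n j : ℕ) :
    hrCoeffHalfLo Δ₁ Δ₂ (n + 3) j =
      if InDescendantRange 0 (n + 3) j then
        ((if j = 0 then 0 else
            hrGammaPlusLo (Δ₁ + (n + 2 : ℕ)) (Δ₂ + (n + 2 : ℕ)) (j - 1) * hrCoeffHalfLo Δ₁ Δ₂ (n + 2) (j - 1)) +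
            hrGammaMinusLo (Δ₁ + (n + 2 : ℕ)) (Δ₂ + (n + 2 : ℕ)) (j + 1) * hrCoeffHalfLo Δ₁ Δ₂ (n + 2) (j + 1)) /
          casimirPivot3D Δ₂ 0 (n + 3) j
      else 0 := by
  rfl

/-- [folklore] -/
private theorem hrCoeffHalfHi_add_three (Δ₁ Δ₂ : ℝ) (n j : ℕ) :
    hrCoeffHalfHi Δ₁ Δ₂ (n + 3) j =
      if InDescendantRange 0 (n + 3) j then
        ((if j = 0 then 0 else
            hrGammaPlusHi (Δ₁ + (n + 2 : ℕ)) (Δ₂ + (n + 2 : ℕ)) (j - 1) * hrCoeffHalfHi Δ₁ Δ₂ (n + 2) (j - 1)) +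
            hrGammaMinusHi (Δ₁ + (n + 2 : ℕ)) (Δ₂ + (n + 2 : ℕ)) (j + 1) * hrCoeffHalfHi Δ₁ Δ₂ (n + 2) (j + 1)) /
          casimirPivot3D Δ₁ 0 (n + 3) j
      else 0 := by
  rfl

/-! ### The enclosure theorem -/

section Sandwich

/-- Level zero: `B_{0,0} = 4Δ - 2 ∈ [4Δ₁ - 2, 4Δ₂ - 2]`, zero elsewhere. [cite: HogervorstRychkov2013, §3 eq. (3.9)] -/
theorem scaled_hrCoeff_sandwich_zero {Δ₁ Δ Δ₂ : ℝ} (h0 : 1 / 2 ≤ Δ₁) (h1 : Δ₁ ≤ Δ) (h2 : Δ ≤ Δ₂)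
    (j : ℕ) :
    0 ≤ hrCoeffHalfLo Δ₁ Δ₂ 0 j ∧ hrCoeffHalfLo Δ₁ Δ₂ 0 j ≤ (4 * Δ - 2) * hrCoeff Δ 0 0 j ∧
      (4 * Δ - 2) * hrCoeff Δ 0 0 j ≤ hrCoeffHalfHi Δ₁ Δ₂ 0 j := by
  by_cases hj : j = 0
  · subst hj
    simp only [hrCoeffHalfLo, hrCoeffHalfHi, if_true, hrCoeff_zero_self, mul_one]
    exact ⟨by linarith, by linarith, by linarith⟩
  · simp only [hrCoeffHalfLo, hrCoeffHalfHi, if_neg hj, hrCoeff_zero_of_ne Δ hj, mul_zero]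
    exact ⟨le_rfl, le_rfl, le_rfl⟩

/-- Level one: `B_{1,1} = (4Δ - 2)·Δ/2`, a product of non-negative non-decreasing factors.
[cite: HogervorstRychkov2013, §3 eq. (3.10)] -/
theorem scaled_hrCoeff_sandwich_one {Δ₁ Δ Δ₂ : ℝ} (h0 : 1 / 2 ≤ Δ₁) (hΔ : 1 / 2 < Δ) (h1 : Δ₁ ≤ Δ)
    (h2 : Δ ≤ Δ₂) (j : ℕ) :
    0 ≤ hrCoeffHalfLo Δ₁ Δ₂ 1 j ∧ hrCoeffHalfLo Δ₁ Δ₂ 1 j ≤ (4 * Δ - 2) * hrCoeff Δ 0 1 j ∧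
      (4 * Δ - 2) * hrCoeff Δ 0 1 j ≤ hrCoeffHalfHi Δ₁ Δ₂ 1 j := by
  by_cases hj : j = 1
  · subst hj
    simp only [hrCoeffHalfLo, hrCoeffHalfHi, if_true, hrCoeff_scalar_one_one hΔ]
    exact mul_sandwich (by linarith) (by linarith) (by linarith) (by linarith) (by linarith)
      (by linarith)
  · simp only [hrCoeffHalfLo, hrCoeffHalfHi, if_neg hj, hrCoeff_scalar_one_of_ne Δ hj, mul_zero]
    exact ⟨le_rfl, le_rfl, le_rfl⟩

/-- Level two: `(2,0)` with the pivot cancelled, `(2,2)` with the pivot `4Δ + 4` crossed, zero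
elsewhere. [cite: KosPolandSimmonsduffin2014, §4 eqs. (4.2)–(4.3)] -/
theorem scaled_hrCoeff_sandwich_two {Δ₁ Δ Δ₂ : ℝ} (h0 : 1 / 2 ≤ Δ₁) (hΔ : 1 / 2 < Δ) (h1 : Δ₁ ≤ Δ)
    (h2 : Δ ≤ Δ₂) (j : ℕ) :
    0 ≤ hrCoeffHalfLo Δ₁ Δ₂ 2 j ∧ hrCoeffHalfLo Δ₁ Δ₂ 2 j ≤ (4 * Δ - 2) * hrCoeff Δ 0 2 j ∧
      (4 * Δ - 2) * hrCoeff Δ 0 2 j ≤ hrCoeffHalfHi Δ₁ Δ₂ 2 j := by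
  have hE1 : Δ₁ + 1 ≤ Δ + 1 := by linarith
  have hE2 : Δ + 1 ≤ Δ₂ + 1 := by linarith
  by_cases hj0 : j = 0
  · subst hj0
    simp only [hrCoeffHalfLo, hrCoeffHalfHi, if_true, scaled_hrCoeff_two_zero hΔ]
    exact mul_sandwich (hrGammaMinusLo_nonneg _ _ _) (hrGammaMinusLo_le hE1 hE2 1)
      (hrGammaMinus_le_hi hE1 hE2 1) (by linarith) (by linarith) (by linarith)
  by_cases hj2 : j = 2
  · subst hj2
    simp only [hrCoeffHalfLo, hrCoeffHalfHi, show ¬ ((2 : ℕ) = 0) from by omega, if_false,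
      if_true, scaled_hrCoeff_two_two hΔ]
    have hpiv : 0 < casimirPivot3D Δ₁ 0 2 2 := by
      show 0 < casimirPivot3D Δ₁ 0 (1 + 1) 2
      rw [casimirPivot3D_scalar_level_two_two]; linarith
    have hp1 := casimirPivot3D_mono h1 0 2 2
    have hp2 := casimirPivot3D_mono h2 0 2 2
    obtain ⟨hN0, hN1, hN2⟩ := mul_sandwich (hrGammaPlusLo_nonneg _ _ _) (hrGammaPlusLo_le hE1 hE2 1)
      (hrGammaPlus_le_hi hE1 hE2 1) (by linarith : (0 : ℝ) ≤ Δ₁ / 2) (by linarith : Δ₁ / 2 ≤ Δ / 2)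
      (by linarith : Δ / 2 ≤ Δ₂ / 2)
    obtain ⟨hQ0, hQ1, hQ2⟩ := div_sandwich hN0 hN1 hN2 hpiv hp1 hp2
    exact mul_sandwich (by linarith) (by linarith) (by linarith) hQ0 hQ1 hQ2
  · simp only [hrCoeffHalfLo, hrCoeffHalfHi, if_neg hj0, if_neg hj2, hrCoeff_scalar_two_of_ne Δ hj0 hj2,
      mul_zero]
    exact ⟨le_rfl, le_rfl, le_rfl⟩

/-- The generic step: from level `n + 2` (all spins) to level `n + 3`, by the linear recursion for the
`B`'s, the `γ`-enclosures and the pivot `0 < P(Δ₁) ≤ P(Δ) ≤ P(Δ₂)` — positive because the level is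
`≥ 3`. [cite: HogervorstRychkov2013, §3 eq. (3.9)] -/
theorem scaled_hrCoeff_sandwich_step {Δ₁ Δ Δ₂ : ℝ} (h0 : 1 / 2 ≤ Δ₁) (h1 : Δ₁ ≤ Δ) (h2 : Δ ≤ Δ₂)
    (n : ℕ)
    (ih : ∀ j, 0 ≤ hrCoeffHalfLo Δ₁ Δ₂ (n + 2) j ∧
      hrCoeffHalfLo Δ₁ Δ₂ (n + 2) j ≤ (4 * Δ - 2) * hrCoeff Δ 0 (n + 2) j ∧
      (4 * Δ - 2) * hrCoeff Δ 0 (n + 2) j ≤ hrCoeffHalfHi Δ₁ Δ₂ (n + 2) j) (j : ℕ) :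
    0 ≤ hrCoeffHalfLo Δ₁ Δ₂ (n + 3) j ∧
      hrCoeffHalfLo Δ₁ Δ₂ (n + 3) j ≤ (4 * Δ - 2) * hrCoeff Δ 0 (n + 3) j ∧
      (4 * Δ - 2) * hrCoeff Δ 0 (n + 3) j ≤ hrCoeffHalfHi Δ₁ Δ₂ (n + 3) j := by
  by_cases hr : InDescendantRange 0 (n + 3) j
  · rw [hrCoeffHalfLo_add_three, hrCoeffHalfHi_add_three, if_pos hr, if_pos hr,
      show n + 3 = (n + 2) + 1 from rfl, scaled_hrCoeff_succ]
    have hpiv : 0 < casimirPivot3D Δ₁ 0 (n + 2 + 1) j :=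
      casimirPivot3D_scalar_pos_of_half_le h0 (by omega) (by omega) hr
    have hp1 := casimirPivot3D_mono h1 0 (n + 2 + 1) j
    have hp2 := casimirPivot3D_mono h2 0 (n + 2 + 1) j
    have hE1 : Δ₁ + ((n + 2 : ℕ) : ℝ) ≤ Δ + ((n + 2 : ℕ) : ℝ) := by linarith
    have hE2 : Δ + ((n + 2 : ℕ) : ℝ) ≤ Δ₂ + ((n + 2 : ℕ) : ℝ) := by linarith
    -- the `γ⁺` parent term
    have hP : 0 ≤ (if j = 0 then (0 : ℝ) else
          hrGammaPlusLo (Δ₁ + (n + 2 : ℕ)) (Δ₂ + (n + 2 : ℕ)) (j - 1) * hrCoeffHalfLo Δ₁ Δ₂ (n + 2) (j - 1)) ∧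
        (if j = 0 then (0 : ℝ) else
          hrGammaPlusLo (Δ₁ + (n + 2 : ℕ)) (Δ₂ + (n + 2 : ℕ)) (j - 1) * hrCoeffHalfLo Δ₁ Δ₂ (n + 2) (j - 1)) ≤
        (if j = 0 then (0 : ℝ) else
          hrGammaPlus (Δ + (n + 2 : ℕ)) (j - 1) * ((4 * Δ - 2) * hrCoeff Δ 0 (n + 2) (j - 1))) ∧
        (if j = 0 then (0 : ℝ) else
          hrGammaPlus (Δ + (n + 2 : ℕ)) (j - 1) * ((4 * Δ - 2) * hrCoeff Δ 0 (n + 2) (j - 1))) ≤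
        (if j = 0 then (0 : ℝ) else
          hrGammaPlusHi (Δ₁ + (n + 2 : ℕ)) (Δ₂ + (n + 2 : ℕ)) (j - 1) * hrCoeffHalfHi Δ₁ Δ₂ (n + 2) (j - 1)) := by
      by_cases hj0 : j = 0
      · simp only [hj0, if_true]; exact ⟨le_rfl, le_rfl, le_rfl⟩
      · simp only [if_neg hj0]
        obtain ⟨hl0, hl, hh⟩ := ih (j - 1)
        exact mul_sandwich (hrGammaPlusLo_nonneg _ _ _) (hrGammaPlusLo_le hE1 hE2 _)
          (hrGammaPlus_le_hi hE1 hE2 _) hl0 hl hh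
    -- the `γ⁻` parent term
    obtain ⟨hm0, hm, hmh⟩ := ih (j + 1)
    have hM := mul_sandwich (hrGammaMinusLo_nonneg _ _ _) (hrGammaMinusLo_le hE1 hE2 (j + 1))
      (hrGammaMinus_le_hi hE1 hE2 (j + 1)) hm0 hm hmh
    obtain ⟨hP0, hPl, hPh⟩ := hP
    obtain ⟨hM0, hMl, hMh⟩ := hM
    exact div_sandwich (add_nonneg hP0 hM0) (add_le_add hPl hMl) (add_le_add hPh hMh) hpiv hp1 hp2
  · rw [hrCoeffHalfLo_add_three, hrCoeffHalfHi_add_three, if_neg hr, if_neg hr,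
      hrCoeff_eq_zero_of_not_inDescendantRange Δ hr, mul_zero]
    exact ⟨le_rfl, le_rfl, le_rfl⟩

/-- **Residue-scaled enclosure down to the scalar unitarity bound.** For `1/2 ≤ Δ₁ ≤ Δ ≤ Δ₂` with
`Δ > 1/2`, for all `n, j`:
`0 ≤ hrCoeffHalfLo Δ₁ Δ₂ n j ≤ (4Δ - 2) · A_{n,j}(Δ) ≤ hrCoeffHalfHi Δ₁ Δ₂ n j` (`ℓ = 0`).
The table parameter `Δ₁` may equal the bound `1/2`; the point `Δ` may not (there `A_{2,0}` is Lean's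
junk value `x/0 = 0` and, mathematically, the pole). Levels `0, 1, 2` by the closed forms, then the
generic step. [cite: HogervorstRychkov2013, §3 eq. (3.9)] -/
theorem scaled_hrCoeff_sandwich {Δ₁ Δ Δ₂ : ℝ} (h0 : 1 / 2 ≤ Δ₁) (hΔ : 1 / 2 < Δ) (h1 : Δ₁ ≤ Δ)
    (h2 : Δ ≤ Δ₂) :
    ∀ n j : ℕ, 0 ≤ hrCoeffHalfLo Δ₁ Δ₂ n j ∧ hrCoeffHalfLo Δ₁ Δ₂ n j ≤ (4 * Δ - 2) * hrCoeff Δ 0 n j ∧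
      (4 * Δ - 2) * hrCoeff Δ 0 n j ≤ hrCoeffHalfHi Δ₁ Δ₂ n j
  | 0, j => scaled_hrCoeff_sandwich_zero h0 h1 h2 j
  | 1, j => scaled_hrCoeff_sandwich_one h0 hΔ h1 h2 j
  | 2, j => scaled_hrCoeff_sandwich_two h0 hΔ h1 h2 j
  | n + 3, j => scaled_hrCoeff_sandwich_step h0 h1 h2 n
      (fun j' => scaled_hrCoeff_sandwich h0 hΔ h1 h2 (n + 2) j') j

/-- The lower table is non-negative (for `1/2 ≤ Δ₁ ≤ Δ₂` with `1/2 < Δ₂`).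
[cite: HogervorstRychkov2013, §3 eq. (3.9)] -/
theorem hrCoeffHalfLo_nonneg {Δ₁ Δ₂ : ℝ} (h0 : 1 / 2 ≤ Δ₁) (h12 : Δ₁ ≤ Δ₂) (h2 : 1 / 2 < Δ₂)
    (n j : ℕ) : 0 ≤ hrCoeffHalfLo Δ₁ Δ₂ n j :=
  (scaled_hrCoeff_sandwich h0 h2 h12 le_rfl n j).1

/-- Membership form: `(4Δ - 2) · A_{n,j}(Δ) ∈ [hrCoeffHalfLo, hrCoeffHalfHi]`.
[cite: HogervorstRychkov2013, §3 eq. (3.9)] -/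
theorem scaled_hrCoeff_mem_Icc {Δ₁ Δ Δ₂ : ℝ} (h0 : 1 / 2 ≤ Δ₁) (hΔ : 1 / 2 < Δ) (h1 : Δ₁ ≤ Δ)
    (h2 : Δ ≤ Δ₂) (n j : ℕ) :
    (4 * Δ - 2) * hrCoeff Δ 0 n j ∈ Icc (hrCoeffHalfLo Δ₁ Δ₂ n j) (hrCoeffHalfHi Δ₁ Δ₂ n j) :=
  ⟨(scaled_hrCoeff_sandwich h0 hΔ h1 h2 n j).2.1, (scaled_hrCoeff_sandwich h0 hΔ h1 h2 n j).2.2⟩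

end Sandwich

/-- **The head-term inequality a cell rule consumes.** On `1/2 ≤ Δ₁ ≤ Δ ≤ Δ₂`, `Δ > 1/2`: if
`Φ ≤ T` and `0 ≤ Lo := hrCoeffHalfLo Δ₁ Δ₂ n j`, then
`min (Lo·Φ) (Hi·Φ) ≤ (4Δ - 2) · A_{n,j}(Δ) · T` — the scaled analogue of the interval-table head term
(`PointFunctionalHead.min_mul_le_mul_of_bounds`, reproved here to keep the imports at the coefficient
layer). [cite: HogervorstRychkov2013, §3 eq. (3.9)] -/
theorem min_halfTables_mul_le {Δ₁ Δ Δ₂ : ℝ} (h0 : 1 / 2 ≤ Δ₁) (hΔ : 1 / 2 < Δ) (h1 : Δ₁ ≤ Δ)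
    (h2 : Δ ≤ Δ₂) (n j : ℕ) {Φ T : ℝ} (hΦ : Φ ≤ T) :
    min (hrCoeffHalfLo Δ₁ Δ₂ n j * Φ) (hrCoeffHalfHi Δ₁ Δ₂ n j * Φ) ≤
      (4 * Δ - 2) * hrCoeff Δ 0 n j * T := by
  obtain ⟨hL0, hL, hH⟩ := scaled_hrCoeff_sandwich h0 hΔ h1 h2 n j
  have hB : 0 ≤ (4 * Δ - 2) * hrCoeff Δ 0 n j := hL0.trans hL
  have hBΦ : (4 * Δ - 2) * hrCoeff Δ 0 n j * Φ ≤ (4 * Δ - 2) * hrCoeff Δ 0 n j * T :=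
    mul_le_mul_of_nonneg_left hΦ hB
  rcases le_or_gt 0 Φ with hpos | hneg
  · exact (min_le_left _ _).trans ((mul_le_mul_of_nonneg_right hL hpos).trans hBΦ)
  · refine (min_le_right _ _).trans (le_trans ?_ hBΦ)
    have : 0 ≤ (hrCoeffHalfHi Δ₁ Δ₂ n j - (4 * Δ - 2) * hrCoeff Δ 0 n j) * (-Φ) :=
      mul_nonneg (by linarith) (by linarith)
    nlinarith

end Literature.MathematicalPhysics.QuantumFieldTheory.ConformalBootstrap3D
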